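import Summits.Ventures.Crystal3D.Theorems.StickyWulffConstantTextureLiminfResolutionOfRigidity
import Summits.Ventures.Crystal3D.Theorems.StickyWulffConstantTextureLiminfCubeRigidity
import HarnessLib

/-!
# Texture build, TB-A: the Barlow resolution with ENLARGED certification (grid cubes, perfect collars)

TB-0.md §9.9 (S1): the grains of the texture build are the good GRID cubes of the resolution, each certified on
the ENLARGED cube of side `M + 2r` around it.  This file re-runs `barlowResolution_of_cubeRigidity`
(…ResolutionOfRigidity) with the margin taken for the enlarged cube and with the tree's PROVED `cubeRigidity_holds`
(…CubeRigidity), keeping the extra information the build needs: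

`barlowResolution_enlarged (hL : L12Local)`: for all `K, δ > 0, M ≥ 1, r ≥ 0` and `N ≥ N₀`, every unit packing with
`6N − b ≤ K N^{2/3}` admits pairwise disjoint GRID cubes `cube (q j) M` (`q j` a grid corner) with moved Barlow
stackings such that every ball in the enlarged cube `cube (q j − r·𝟙) (M + 2r)` lies on cube `j`'s stacking AND has
a close-packed first shell, the cubes capturing `≥ (1 − δ)N` balls.  Conditional only on `L12Local` (as
`stub_resolution`).
-/

noncomputable section

namespace Summit.Ventures.Crystal3D.Theorems

open Finset Metric
open Literature.MathematicalPhysics.StatisticalMechanics (IsHaggSeq)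
open Summit.Ventures.Crystal3D.Cruxes.TextureLiminf.TexShadow (E3 stacking cube)

/-! ## Shifted corners -/

/-- the corner of the enlarged cube: `q − r·𝟙`. -/
def shiftCorner (q : E3) (r : ℝ) : E3 := WithLp.toLp 2 fun t => q t - r

/-- Coordinates of the shifted corner. -/
theorem shiftCorner_apply (q : E3) (r : ℝ) (t : Fin 3) : shiftCorner q r t = q t - r := rfl

/-- The enlarged cube contains the cube (`r ≥ 0`). -/
theorem mem_cube_shiftCorner {q p : E3} {M r : ℝ} (hr : 0 ≤ r) (hp : p ∈ cube q M) :
    p ∈ cube (shiftCorner q r) (M + 2 * r) := by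
  intro t
  rw [shiftCorner_apply]
  obtain ⟨h1, h2⟩ := hp t
  constructor <;> linarith

/-! ## The enlarged resolution -/

open scoped Classical in
/-- **Barlow resolution with enlarged certification.**  See the module docstring. -/
theorem barlowResolution_enlarged (hL : L12Local) :
    ∀ K δ M r : ℝ, 0 < δ → 1 ≤ M → 0 ≤ r → ∃ N₀ : ℕ, ∀ N : ℕ, N₀ ≤ N → ∀ x : Fin N → E3, IsUnitPacking x →
    6 * (N : ℝ) - (numContacts x : ℝ) ≤ K * (N : ℝ) ^ ((2 : ℝ) / 3) →
    ∃ (J : ℕ) (q : Fin J → E3) (L : Fin J → (E3 ≃ₗᵢ[ℝ] E3)) (s : Fin J → E3) (σ : Fin J → ℤ → ℤ),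
      (∀ j, IsHaggSeq (σ j)) ∧
      (∀ j, ∃ i, q j = gridCorner M (x i)) ∧
      (∀ j j', j ≠ j' → Disjoint (cube (q j) M) (cube (q j') M)) ∧
      (∀ j i, x i ∈ cube (shiftCorner (q j) r) (M + 2 * r) → x i ∈ stacking (L j) (s j) (σ j)) ∧
      (∀ j i, x i ∈ cube (shiftCorner (q j) r) (M + 2 * r) → IsClosePackedShell x i) ∧
      (1 - δ) * (N : ℝ) ≤ ((Finset.univ.filter fun i => ∃ j, x i ∈ cube (q j) M).card : ℝ) := by
  classical
  intro K δ M r hδ hM hr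
  have hM0 : 0 < M := by linarith
  have hM' : 1 ≤ M + 2 * r := by linarith
  have hM'0 : 0 < M + 2 * r := by linarith
  obtain ⟨D, hD0, hD⟩ := cubeRigidity_holds (M + 2 * r) hM'
  -- constants
  set R : ℝ := 2 * (M + 2 * r + D) with hRdef
  have hR1 : 1 ≤ R := by rw [hRdef]; linarith
  set c₁ : ℝ := (2 * R + 1) ^ 3 with hc₁
  have hc₁0 : 0 ≤ c₁ := by rw [hc₁]; positivity
  set A : ℝ := max 0 (24 * K * c₁ / δ) with hAdef
  have hA0 : 0 ≤ A := le_max_left _ _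
  have hAK : 24 * K * c₁ ≤ δ * A := by
    have : 24 * K * c₁ / δ ≤ A := le_max_right _ _
    rw [div_le_iff₀ hδ] at this
    calc 24 * K * c₁ ≤ A * δ := this
      _ = δ * A := mul_comm _ _
  obtain ⟨N₀, hN₀⟩ := exists_nat_ge (A ^ 3)
  refine ⟨N₀, fun N hN x hx hdef => ?_⟩
  -- (1) defects
  set B : Finset (Fin N) := nonClosePacked x with hBdef
  have hB : (B.card : ℝ) ≤ 24 * K * (N : ℝ) ^ ((2 : ℝ) / 3) := by
    have := card_nonClosePacked_le hL hx
    rw [← hBdef] at this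
    nlinarith
  -- (2)/(3) lost and kept balls
  set spoil : Fin N → Fin N → Prop := fun j i =>
    ∀ t : Fin 3, shiftCorner (gridCorner M (x i)) r t - D ≤ x j t ∧
      x j t ≤ shiftCorner (gridCorner M (x i)) r t + (M + 2 * r) + D with hspoil
  set Lost : Finset (Fin N) := univ.filter fun i => ∃ j ∈ B, spoil j i with hLost
  set Good : Finset (Fin N) := univ.filter fun i => ¬ ∃ j ∈ B, spoil j i with hGood
  have hLost_le : (Lost.card : ℝ) ≤ (B.card : ℝ) * c₁ := by
    have hsub : Lost ⊆ B.biUnion fun j => univ.filter fun i => dist (x i) (x j) ≤ R := by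
      intro i hi
      rw [hLost, Finset.mem_filter] at hi
      obtain ⟨j, hjB, hji⟩ := hi.2
      rw [Finset.mem_biUnion]
      refine ⟨j, hjB, Finset.mem_filter.2 ⟨Finset.mem_univ _, ?_⟩⟩
      exact dist_le_of_mem_cube_of_mem_nbhd hM'0 hD0
        (mem_cube_shiftCorner hr (mem_cube_gridCorner hM0 (x i))) hji
    calc (Lost.card : ℝ) ≤ ((B.biUnion fun j => univ.filter fun i => dist (x i) (x j) ≤ R).card : ℝ) := by
          exact_mod_cast Finset.card_le_card hsub
      _ ≤ ∑ j ∈ B, (((univ.filter fun i => dist (x i) (x j) ≤ R).card : ℕ) : ℝ) := by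
          exact_mod_cast Finset.card_biUnion_le
      _ ≤ ∑ _j ∈ B, c₁ := Finset.sum_le_sum fun j _ => card_filter_dist_le hx j hR1
      _ = (B.card : ℝ) * c₁ := by rw [Finset.sum_const, nsmul_eq_mul]
  have hGood_card : (Good.card : ℝ) = (N : ℝ) - Lost.card := by
    have hsum : Lost.card + Good.card = N := by
      rw [hLost, hGood, Finset.card_filter_add_card_filter_not, Finset.card_univ, Fintype.card_fin]
    have := congrArg (fun n : ℕ => (n : ℝ)) hsum
    simp only [Nat.cast_add] at this
    linarith
  -- (4) the rigidity on every kept ball's cube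
  have hgoodCube : ∀ i ∈ Good, ∀ j : Fin N, (∀ t : Fin 3, shiftCorner (gridCorner M (x i)) r t - D ≤ x j t ∧
      x j t ≤ shiftCorner (gridCorner M (x i)) r t + (M + 2 * r) + D) → IsClosePackedShell x j := by
    intro i hi j hj
    rw [hGood, Finset.mem_filter] at hi
    by_contra hbad
    exact hi.2 ⟨j, mem_nonClosePacked.2 hbad, hj⟩
  set C : Finset E3 := Good.image fun i => gridCorner M (x i) with hCdef
  have hCmem : ∀ qc ∈ C, ∃ i ∈ Good, gridCorner M (x i) = qc := fun qc hqc => by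
    rw [hCdef, Finset.mem_image] at hqc; exact hqc
  have key : ∀ qc ∈ C, ∃ (L : E3 ≃ₗᵢ[ℝ] E3) (s : E3) (σ : ℤ → ℤ), IsHaggSeq σ ∧
      ∀ i : Fin N, x i ∈ cube (shiftCorner qc r) (M + 2 * r) → x i ∈ stacking L s σ := by
    intro qc hqc
    obtain ⟨i, hi, rfl⟩ := hCmem qc hqc
    exact hD N x hx (shiftCorner (gridCorner M (x i)) r) (hgoodCube i hi)
  have hperfC : ∀ qc ∈ C, ∀ i : Fin N, x i ∈ cube (shiftCorner qc r) (M + 2 * r) → IsClosePackedShell x i := by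
    intro qc hqc i' hi'
    obtain ⟨i, hi, rfl⟩ := hCmem qc hqc
    refine hgoodCube i hi i' fun t => ?_
    obtain ⟨h1, h2⟩ := hi' t
    constructor <;> linarith
  choose! Lf sf σf hσf hstf using key
  -- enumerate the cubes
  set J : ℕ := C.card
  let e : Fin J ≃ {qc // qc ∈ C} := C.equivFin.symm
  refine ⟨J, fun j => (e j : E3), fun j => Lf (e j), fun j => sf (e j), fun j => σf (e j),
    fun j => hσf _ (e j).2, ?_, ?_, ?_, ?_, ?_⟩
  · -- grid corners
    intro j
    obtain ⟨i, -, hi⟩ := hCmem _ (e j).2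
    exact ⟨i, hi.symm⟩
  · -- disjointness
    intro j j' hjj'
    show Disjoint (cube (e j : E3) M) (cube (e j' : E3) M)
    have hne : ((e j : E3)) ≠ (e j' : E3) := fun h => hjj' (e.injective (Subtype.ext h))
    obtain ⟨i, -, hi⟩ := hCmem _ (e j).2
    obtain ⟨i', -, hi'⟩ := hCmem _ (e j').2
    rw [← hi, ← hi'] at hne ⊢
    exact disjoint_cube_gridCorner hM0 hne
  · -- every ball in an enlarged cube lies on that cube's stacking
    intro j i hi
    exact hstf _ (e j).2 i hi
  · -- every ball in an enlarged cube is perfect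
    intro j i hi
    exact hperfC _ (e j).2 i hi
  · -- the count
    have hsubset : Good ⊆ univ.filter fun i => ∃ j : Fin J, x i ∈ cube (e j : E3) M := by
      intro i hi
      refine Finset.mem_filter.2 ⟨Finset.mem_univ _, ?_⟩
      have hmem : gridCorner M (x i) ∈ C := by rw [hCdef]; exact Finset.mem_image_of_mem _ hi
      refine ⟨e.symm ⟨gridCorner M (x i), hmem⟩, ?_⟩
      rw [Equiv.apply_symm_apply]
      exact mem_cube_gridCorner hM0 (x i)
    have hcount : (Good.card : ℝ) ≤ ((univ.filter fun i => ∃ j : Fin J, x i ∈ cube (e j : E3) M).card : ℝ) := by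
      exact_mod_cast Finset.card_le_card hsubset
    -- `Lost ≤ 24 K c₁ N^{2/3} ≤ δ N`
    have hN1 : (A ^ 3 : ℝ) ≤ N := hN₀.trans (by exact_mod_cast hN)
    have hNnn : (0 : ℝ) ≤ N := Nat.cast_nonneg N
    have hcube : A ≤ (N : ℝ) ^ ((1 : ℝ) / 3) := by
      rw [show ((1 : ℝ) / 3) = ((3 : ℕ) : ℝ)⁻¹ by norm_num]
      calc A = (A ^ 3) ^ (((3 : ℕ) : ℝ)⁻¹) := (Real.pow_rpow_inv_natCast hA0 (by norm_num)).symm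
        _ ≤ (N : ℝ) ^ (((3 : ℕ) : ℝ)⁻¹) := Real.rpow_le_rpow (by positivity) hN1 (by positivity)
    have hsplit : (N : ℝ) ^ ((2 : ℝ) / 3) * (N : ℝ) ^ ((1 : ℝ) / 3) = (N : ℝ) := by
      rcases Nat.eq_zero_or_pos N with hz | hpos
      · subst hz; simp
      · rw [← Real.rpow_add (by exact_mod_cast hpos)]; norm_num
    have h23 : 0 ≤ (N : ℝ) ^ ((2 : ℝ) / 3) := Real.rpow_nonneg hNnn _
    have hlost : (Lost.card : ℝ) ≤ δ * N := by
      calc (Lost.card : ℝ) ≤ (B.card : ℝ) * c₁ := hLost_le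
        _ ≤ 24 * K * (N : ℝ) ^ ((2 : ℝ) / 3) * c₁ := mul_le_mul_of_nonneg_right hB hc₁0
        _ = (24 * K * c₁) * (N : ℝ) ^ ((2 : ℝ) / 3) := by ring
        _ ≤ (δ * A) * (N : ℝ) ^ ((2 : ℝ) / 3) := mul_le_mul_of_nonneg_right hAK h23
        _ ≤ (δ * (N : ℝ) ^ ((1 : ℝ) / 3)) * (N : ℝ) ^ ((2 : ℝ) / 3) :=
            mul_le_mul_of_nonneg_right (mul_le_mul_of_nonneg_left hcube hδ.le) h23
        _ = δ * ((N : ℝ) ^ ((2 : ℝ) / 3) * (N : ℝ) ^ ((1 : ℝ) / 3)) := by ring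
        _ = δ * N := by rw [hsplit]
    rw [hGood_card] at hcount
    linarith

end Summit.Ventures.Crystal3D.Theorems
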